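/-
Copyright (c) 2026 the pub-hodgecm-mathlib formalisation cell (harness21).  Prover seat hodgecm-mathlib-LH4-p18 (g3), Track A «FOUR-FRAME» hand on VALVE loan to
Track B «K2-LIT», #184♮ = hLiu418 = `stmt-HodgeConjecture-24832`; desk K2Liu-p14 (g4) DESK WORD #6 (b), task (P-supp-lat), three-file cut «=»: (lat-a) ★ p863378
`K2LiuUnipotentDeepLevel`, (lat-b) ★ p863429 `K2LiuUnipotentConjLevelGlobal`, (lat-c) THIS FILE — the `hlatU` letter of the ★-cand `K2LiuKindOneLineTermEngine`, GLOBAL half,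
hypothesis-first on ONE by-value local lattice letter `hloc` (membership-deep, single depth per place of `L⁺`).
THEOREMS ONLY (no `def`, no `instance`, no notation, no named-fact hypothesis, no `sorry`).
-/
import Summits.HodgeConjecture.HodgeConjecture.Theorems.K2LiuOpenSubgroupCongruenceLevel      -- ★ (ρ5) `exists_finset_forall_evalAt_mem_congruenceGL_imp_mem`
import Summits.HodgeConjecture.HodgeConjecture.Theorems.K2LiuUnipotentConjLevelGlobal        -- ★ (lat-b) `forall_evalAt_finPart_conj_locToAdelic_mem_congruenceGL`, `archPart_locToAdelic_eq_one`
import Summits.HodgeConjecture.HodgeConjecture.Theorems.K2LiuKindOneLineLevelConjugation     -- ★ `localHeight_smul_le_pow_of_le_pow` (split place), brings ★ (c1) `exists_localHeight_eq_pow`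
import Summits.HodgeConjecture.HodgeConjecture.Theorems.K2LiuSiegelUnipotentFourierDefs      -- `unipDeltaChar`, `skewMatrices`; brings `unipDelta`
import Summits.HodgeConjecture.HodgeConjecture.Theorems.K2LiuLocalLFactorDefs                -- `unifAt`, `valued_unifAt`
import Literature.NumberTheory.GelbartRogawski1991.DoubledWeilRepresentationDetTwist          -- ★ `DoubledWeilDetTwist.det_hermD_ne_zero`
import Literature.NumberTheory.Automorphic.AdelicHeightGLProofs                               -- ★ `GLn.eventually_localHeight_eq_one`
import Literature.NumberTheory.Automorphic.UnitaryGroupSplitPlace                             -- ★ `PlacesOver.eq_or_eq_galInv`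
import Literature.NumberTheory.Automorphic.ValuedFieldValuativeRelBridge                      -- ★ `v_le_iff_valuation_le`
import HarnessLib

/-!
# Crux `HLiu418`, socket #42F′ (kind-one line term), file (lat-c) — `K2LiuKindOneLineLatticeLetters`:
# THE `hlatU` LETTER OF THE LINE-TERM ENGINE FROM ONE LOCAL LATTICE LETTER

Cell `hodgecm-mathlib`, crux item hLiu418 = `stmt-HodgeConjecture-24832` (helper lane `--supports … --as helper`, count-neutral), route of record `HCCMUnconditional`;
squad K2 ∕ K2Liu, road `K2_Liu`, desk K2Liu-p14 (g4) DESK WORD #6 (b): the binder `hlatU` of the ★-cand `K2LiuKindOneLineTermEngine` (taken there BY VALUE).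

THE STATEMENT PAID (`hlatU`, desk bytes, socket-generic `n`, `e : Fin N × Fin M ≃ Fin n`): for every OPEN subgroup `U` of `H(𝔸_{L⁺,f})` there are a finite set
`Tδ` of places of `L`, defects `δ : w ↦ ℕ` vanishing off `Tδ`, and an exponent `k`, such that for every rational `T^R`-skew matrix `S` and every `h ∈ H(𝔸)`:
if the character `χ_S` of the Siegel unipotent `N_Δ(𝔸)` is trivial on every `b ∈ N_Δ(𝔸)` with `b_∞ = 1` and `(h⁻¹ b h)_f ∈ U`, then at every finite place `w` of `L`,
`|S_{ab}|_w ≤ q_w^{m_w}` with `q_w^{m_w} ≤ q_w^{δ_w} · H_w(h)^k`.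

THE CUT.  Everything GLOBAL is proved here; the one LOCAL input is the by-value letter `hloc` (the target of the local payer — F0P2-p09's ★ p863078
`K2LiuKindOneLineCharacterBoundTwo` §3 + his ED.2 `K2LiuKindOneLineCharacterBoundTwoGeneral` + ★ (lat-a) `K2LiuUnipotentDeepLevel` + ★ `K2LiuRankOneCornerCharacterReading`):
for a place `v` of `L⁺`, a place `w ∣ v` of `L`, a depth `Mv : ℕ` and a skew `S` — IF `χ_S(ι_v u) = 1` for every local `u ∈ H(L⁺_v)` whose components at ALL `w′ ∣ v` lie in the
principal congruence subgroup `K_{w′}(ϖ_{w′}^{Mv})` (`ϖ_{w′} := unifAt L w′`) and whose place inclusion `ι_v u` lies in `N_Δ(𝔸)`, THEN `|S_{ab}|_w ≤ q_w^{2·Mv + D_w}` (slope `2` absorbs the ramification index `e(w|v) ≤ 2` of a `v`-deep test read in `w`-units), the defect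
`D : w ↦ ℕ` vanishing off a finite set `Bad` of places of `L` (conductor of `ψ_v`, `|2|_w`, `|δ|_w`, `|T^R|_w`).  MEMBERSHIP-deep (not coordinate-deep): the dyadic
bookkeeping `|t| ≤ |2|·|ϖ|^M ⇒ n(t) ∈ K(ϖ^M)` stays on the local side, inside `D`.
THE GLOBAL PROOF (§3 `hlatU_of_latticeLocal`):
* levels of `U`: ★ (ρ5) `exists_finset_forall_evalAt_mem_congruenceGL_imp_mem` — `T`, `m : w ↦ ℕ` (`= 0` off `T`) with `(∀ w, x_w ∈ K_w(ϖ_w^{m_w})) ⇒ x ∈ U`;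
* heights: `H_w(h) = q_w^{a₀}` (★ (c1) `exists_localHeight_eq_pow`), and over a SPLIT `v = w·w̄` the other place is controlled by the SAME `H_w(h)`:
  `H_{w̄}(h) ≤ q^{j_w + a₀ + j_w}` (★ `localHeight_smul_le_pow_of_le_pow`, `h ∈ U(J^𝔻)(𝔸)`, `J^𝔻` invertible by ★ `det_hermD_ne_zero` — this is where `hdV0`, `hdW0` enter),
  `H_w(J^𝔻) ≤ q_w^{j_w}` with `j_w = 0` for almost all `w` (★ `GLn.eventually_localHeight_eq_one`) — §1, §2;
* conjugation: ★ (lat-b) `forall_evalAt_finPart_conj_locToAdelic_mem_congruenceGL` — `u_{w′} ∈ K_{w′}(ϖ^{m_{w′} + 2A})` for all `w′ ∣ v` (`A := j_w + a₀ + j_w`) ⇒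
  `((h⁻¹ ι_v(u) h)_f)_{w″} ∈ K_{w″}(ϖ^{m_{w″}})` for ALL `w″`, hence `(h⁻¹ ι_v(u) h)_f ∈ U`; `(ι_v u)_∞ = 1` (★ `archPart_locToAdelic_eq_one`);
* so the premise of `hlatU` feeds `hloc` at the single depth `Mv := m_w + m_{c⁻¹•w} + 2A` (monotonicity ★ `congruenceGL_mono`; the places over `v` are `w`, `c⁻¹ • w` —
  ★ `PlacesOver.eq_or_eq_galInv`), giving `|S_{ab}|_w ≤ q_w^{2Mv + D_w} = q_w^{δ_w} · (q_w^{a₀})⁴ = q_w^{δ_w} · H_w(h)⁴` with `δ_w := 2(m_w + m_{c⁻¹•w} + 4 j_w) + D_w`, `k := 4`;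
* `δ_w = 0` off a finite set: `m` off `T`, `m ∘ (c⁻¹ • ·)` off `c • T` (injective action), `j` cofinitely, `D` off `Bad`.
[BorelJacquet1979, §1.2, §4.1] [MoeglinWaldspurger1995, I.2.2] [PlatonovRapinchuk1994, §5.1].
HONEST LABEL.  Count-neutral helper, closes no socket; `hlatU` is paid MODULO the one printed local letter `hloc` (by value, no named-fact `Prop`): `HC_CM` is proved only
modulo the 7 printed citations (2 remaining named inputs: hLiu418 = `stmt-HodgeConjecture-24832`, h413 = `stmt-HodgeConjecture-24833`) until rung 0 closes.

## References
* [BorelJacquet1979] A. Borel, H. Jacquet, *Automorphic forms and automorphic representations*, Proc. Sympos. Pure Math. 33.1 (1979): §1.2 (heights), §4.1 (levels).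
* [MoeglinWaldspurger1995] C. Moeglin, J.-L. Waldspurger, *Spectral Decomposition and Eisenstein Series* (1995): I.2.2 (local heights, almost all `1`).
* [PlatonovRapinchuk1994] V. Platonov, A. Rapinchuk, *Algebraic Groups and Number Theory* (1994): §5.1 (adelic points, congruence subgroups).
-/

set_option autoImplicit false
set_option linter.dupNamespace false -- the mandated namespace repeats `HodgeConjecture.HodgeConjecture`

noncomputable section

open scoped NNReal MatrixGroups
open NumberField IsDedekindDomain Matrix ValuativeRel Filter
open Literature.NumberTheory.Automorphic Literature.NumberTheory.Automorphic.UnitaryGroup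
open Literature.NumberTheory.GelbartRogawski1991 Literature.NumberTheory.GelbartRogawski1991.GRConstruction
open Literature.NumberTheory.K2Lit.SiegelDoubled
open Summit.HodgeConjecture.HodgeConjecture.Cruxes.HLiu418.K2LiuSiegelUnipotentFourierDefs (unipDeltaChar skewMatrices)
open Summit.HodgeConjecture.HodgeConjecture.Cruxes.HLiu418.K2LiuLocalLFactorDefs (unifAt valued_unifAt)
open Summit.HodgeConjecture.HodgeConjecture.Cruxes.HLiu418.K2LiuLocalHeightLevelConjugation (exists_localHeight_eq_pow one_lt_absNorm_nnreal)
open Summit.HodgeConjecture.HodgeConjecture.Cruxes.HLiu418.K2LiuKindOneLineLevelConjugation (localHeight_smul_le_pow_of_le_pow)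
open Summit.HodgeConjecture.HodgeConjecture.Cruxes.HLiu418.K2LiuOpenSubgroupCongruenceLevel (exists_finset_forall_evalAt_mem_congruenceGL_imp_mem)
open Summit.HodgeConjecture.HodgeConjecture.Cruxes.HLiu418.K2LiuUnipotentConjLevelGlobal (forall_evalAt_finPart_conj_locToAdelic_mem_congruenceGL archPart_locToAdelic_eq_one)

namespace Summit.HodgeConjecture.HodgeConjecture.Cruxes.HLiu418.K2LiuKindOneLineLatticeLetters

variable (L : Type) [Field L] [NumberField L] [IsCMField L]
variable {N M n : ℕ} (e : Fin N × Fin M ≃ Fin n)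
  (dV : Fin N → L) (hdV : ∀ i, IsCMField.complexConj L (dV i) = dV i)
  (dW : Fin M → L) (hdW : ∀ i, IsCMField.complexConj L (dW i) = dW i)

/-! ## §1 An invertible adelic realisation of `J^𝔻` and its (almost everywhere trivial) local heights -/

/-- **`J^𝔻` as an element of `GL_{2n}(𝔸_L)`**: `det J^𝔻 ≠ 0` (★ `det_hermD_ne_zero`), so the diagonal image of `J^𝔻 ∈ GL_{2n}(L)` realises the adelic form
`adelicForm L (n+n) J^𝔻 = J^𝔻.map (L → 𝔸_L)`. [cite: PlatonovRapinchuk1994, §5.1] -/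
theorem exists_coe_eq_adelicForm_hermD (hdV0 : ∀ i, dV i ≠ 0) (hdW0 : ∀ i, dW i ≠ 0) :
    ∃ Jm : GL (Fin (n + n)) (AdeleRing (𝓞 L) L),
      (Jm : Matrix (Fin (n + n)) (Fin (n + n)) (AdeleRing (𝓞 L) L)) = adelicForm L (n + n) (hermD L e dV hdV dW hdW) :=
  ⟨Matrix.GeneralLinearGroup.map (algebraMap L (AdeleRing (𝓞 L) L))
      (Matrix.GeneralLinearGroup.mkOfDetNeZero _ (DoubledWeilDetTwist.det_hermD_ne_zero L e dV hdV hdV0 dW hdW hdW0)), rfl⟩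

omit [IsCMField L] in
/-- **local heights of a fixed adelic point are powers `q_w^{j_w}` with `j_w = 0` for almost all `w`** (★ (c1) `exists_localHeight_eq_pow` place by place, ★
`GLn.eventually_localHeight_eq_one`). [cite: BorelJacquet1979, §1.2] [cite: MoeglinWaldspurger1995, I.2.2] -/
theorem exists_cofinite_localHeight_le_pow {K : ℕ} [NeZero K] (g : GL (Fin K) (AdeleRing (𝓞 L) L)) :
    ∃ j : HeightOneSpectrum (𝓞 L) → ℕ, (∀ᶠ w in cofinite, j w = 0) ∧
      ∀ w : HeightOneSpectrum (𝓞 L), GLn.localHeight K L w g ≤ ((Ideal.absNorm w.asIdeal : ℕ) : ℝ≥0) ^ j w := by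
  classical
  choose jf hjf using fun w : HeightOneSpectrum (𝓞 L) => exists_localHeight_eq_pow L w g
  refine ⟨fun w => if GLn.localHeight K L w g = 1 then 0 else jf w, ?_, fun w => ?_⟩
  · exact (GLn.eventually_localHeight_eq_one (n := K) (K := L) g).mono fun w hw => by simp only [hw, if_true]
  · show GLn.localHeight K L w g ≤ ((Ideal.absNorm w.asIdeal : ℕ) : ℝ≥0) ^ (if GLn.localHeight K L w g = 1 then 0 else jf w)
    by_cases h1 : GLn.localHeight K L w g = 1
    · rw [if_pos h1, h1, pow_zero]
    · rw [if_neg h1]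
      exact (hjf w).le

/-! ## §2 Over a split place: BOTH places above `v` are controlled by `H_w(h)` -/

/-- **`H_{w′}(h) ≤ q_{w′}^{j_w + a₀ + j_w}` for every `w′ ∣ (w ∩ L⁺)`**, from `H_w(h) = q_w^{a₀}` and `H_{w″}(J^𝔻) ≤ q_{w″}^{j_{w″}}`: the places over `v = w ∩ L⁺` are `w` itself
(`a₀ ≤ j + a₀ + j`, `q_w ≥ 1`) and `c⁻¹ • w = c • w` (★ `localHeight_smul_le_pow_of_le_pow`, `h ∈ U(J^𝔻)(𝔸)`, `c² = 1`). [cite: BorelJacquet1979, §1.2] [cite: PlatonovRapinchuk1994, §5.1] -/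
theorem localHeight_le_pow_of_placesOver (Jm : GL (Fin (n + n)) (AdeleRing (𝓞 L) L))
    (hJm : (Jm : Matrix (Fin (n + n)) (Fin (n + n)) (AdeleRing (𝓞 L) L)) = adelicForm L (n + n) (hermD L e dV hdV dW hdW))
    (j : HeightOneSpectrum (𝓞 L) → ℕ) (hJw : ∀ w : HeightOneSpectrum (𝓞 L), GLn.localHeight (n + n) L w Jm ≤ ((Ideal.absNorm w.asIdeal : ℕ) : ℝ≥0) ^ j w)
    (h : HA L e dV hdV dW hdW) (w : HeightOneSpectrum (𝓞 L)) {a₀ : ℕ}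
    (ha₀ : GLn.localHeight (n + n) L w (h : GL (Fin (n + n)) (AdeleRing (𝓞 L) L)) = ((Ideal.absNorm w.asIdeal : ℕ) : ℝ≥0) ^ a₀) :
    ∀ w' : UnitaryGroup.PlacesOver L (w.under (𝓞 (Fp L))),
      GLn.localHeight (n + n) L w'.1 (h : GL (Fin (n + n)) (AdeleRing (𝓞 L) L)) ≤ ((Ideal.absNorm w'.1.asIdeal : ℕ) : ℝ≥0) ^ (j w + a₀ + j w) := by
  intro w'
  have hcc : IsCMField.complexConj L * IsCMField.complexConj L = 1 := AlgEquiv.ext fun x => IsCMField.complexConj_apply_apply L x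
  rcases PlacesOver.eq_or_eq_galInv (F := Fp L) (E := L) (IsCMField.complexConj L) (IsCMField.complexConj_ne_one L)
      (⟨w, rfl⟩ : UnitaryGroup.PlacesOver L (w.under (𝓞 (Fp L)))) w' with rfl | rfl
  · -- `w′ = w`
    show GLn.localHeight (n + n) L w (h : GL (Fin (n + n)) (AdeleRing (𝓞 L) L)) ≤ ((Ideal.absNorm w.asIdeal : ℕ) : ℝ≥0) ^ (j w + a₀ + j w)
    rw [ha₀]
    exact pow_le_pow_right₀ (one_lt_absNorm_nnreal L w).le (by omega)
  · -- `w′ = c⁻¹ • w = c • w`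
    show GLn.localHeight (n + n) L ((IsCMField.complexConj L)⁻¹ • w) (h : GL (Fin (n + n)) (AdeleRing (𝓞 L) L)) ≤
      ((Ideal.absNorm ((IsCMField.complexConj L)⁻¹ • w).asIdeal : ℕ) : ℝ≥0) ^ (j w + a₀ + j w)
    rw [inv_eq_of_mul_eq_one_right hcc]
    exact localHeight_smul_le_pow_of_le_pow (F := Fp L) (E := L) (c := IsCMField.complexConj L) (N := n + n) (J := hermD L e dV hdV dW hdW)
      hcc Jm hJm h w (hJw w) ha₀.le

/-! ## §3 The `hlatU` letter from the local lattice letter -/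

omit [IsCMField L] in
/-- `|ϖ_w| ≤ 1` in the `ValuativeRel` currency of `congruenceGL` (★ `valued_unifAt`, ★ `v_le_iff_valuation_le`). [cite: BorelJacquet1979, §4.1] -/
theorem valuation_unifAt_le_one (w : HeightOneSpectrum (𝓞 L)) : valuation (w.adicCompletion L) (unifAt L w) ≤ 1 := by
  have h1 : Valued.v (unifAt L w) ≤ Valued.v (1 : w.adicCompletion L) := by
    rw [valued_unifAt, map_one, ← WithZero.exp_zero]
    exact WithZero.exp_le_exp.2 (by norm_num)
  simpa only [map_one] using (v_le_iff_valuation_le _ _).1 h1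

/-- **THE `hlatU` LETTER OF THE LINE-TERM ENGINE** (desk K2Liu-p14 WORD #6 (b) bytes), from the by-value LOCAL LATTICE LETTER `hloc` with defects `D` vanishing off `Bad`:
for every open `U ≤ H(𝔸_{L⁺,f})` there are `Tδ`, `δ` (`= 0` off `Tδ`) and `k` (`:= 4`) such that, whenever `χ_S` is trivial on the `b ∈ N_Δ(𝔸)` with `b_∞ = 1` and
`(h⁻¹ b h)_f ∈ U`, every entry of `S` satisfies `|S_{ab}|_w ≤ q_w^{m}` with `q_w^{m} ≤ q_w^{δ_w} · H_w(h)^k` at every finite place `w` of `L`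
(`m := 2(m_w + m_{c⁻¹•w} + 2(2 j_w + a₀)) + D_w`, `H_w(h) = q_w^{a₀}`; §1–§2, ★ (ρ5), ★ (lat-b)). [cite: BorelJacquet1979, §1.2, §4.1] [cite: MoeglinWaldspurger1995, I.2.2] -/
theorem hlatU_of_latticeLocal (hdV0 : ∀ i, dV i ≠ 0) (hdW0 : ∀ i, dW i ≠ 0) (D : HeightOneSpectrum (𝓞 L) → ℕ) (Bad : Finset (HeightOneSpectrum (𝓞 L))) (hD : ∀ w ∉ Bad, D w = 0)
    (hloc : ∀ (v : HeightOneSpectrum (𝓞 (Fp L))) (w : UnitaryGroup.PlacesOver L v) (Mv : ℕ)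
      (S : skewMatrices ((IsCMField.complexConj L : L ≃ₐ[Fp L] L) : L →+* L) ((gramR L e dV hdV dW hdW).map (algebraMap (Fp L) L))),
      (∀ u : UnitaryGroup.localPi L (IsCMField.complexConj L) (n + n) (hermD L e dV hdV dW hdW) v,
          (∀ w' : UnitaryGroup.PlacesOver L v,
            (u : UnitaryGroup.LocalGLPi L (n + n) v) w' ∈ congruenceGL (n + n) (valuation (w'.1.adicCompletion L) (unifAt L w'.1) ^ Mv)) →
          (locToAdelic L e dV hdV dW hdW v u : HA L e dV hdV dW hdW) ∈ unipDelta L e dV hdV dW hdW →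
          unipDeltaChar L e dV hdV dW hdW (S : Matrix (Fin n) (Fin n) L) (locToAdelic L e dV hdV dW hdW v u) = 1) →
      ∀ a b, Valued.v ((((S : Matrix (Fin n) (Fin n) L) a b : L)) : w.1.adicCompletion L) ≤ WithZero.exp (2 * (Mv : ℤ) + D w.1)) :
    ∀ U : Subgroup (UnitaryGroup.finAdelic (Fp L) L (IsCMField.complexConj L) (n + n) (hermD L e dV hdV dW hdW)),
      IsOpen (U : Set (UnitaryGroup.finAdelic (Fp L) L (IsCMField.complexConj L) (n + n) (hermD L e dV hdV dW hdW))) →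
      ∃ (Tδ : Finset (HeightOneSpectrum (𝓞 L))) (δ : HeightOneSpectrum (𝓞 L) → ℕ) (k : ℕ), (∀ w ∉ Tδ, δ w = 0) ∧
        ∀ (S : skewMatrices ((IsCMField.complexConj L : L ≃ₐ[Fp L] L) : L →+* L) ((gramR L e dV hdV dW hdW).map (algebraMap (Fp L) L)))
          (h : HA L e dV hdV dW hdW),
          (∀ b : unipDelta L e dV hdV dW hdW,
            UnitaryGroup.archPart (Fp L) L (IsCMField.complexConj L) (n + n) (hermD L e dV hdV dW hdW) (b : HA L e dV hdV dW hdW) = 1 →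
            UnitaryGroup.finPart (Fp L) L (IsCMField.complexConj L) (n + n) (hermD L e dV hdV dW hdW) (h⁻¹ * (b : HA L e dV hdV dW hdW) * h) ∈ U →
            unipDeltaChar L e dV hdV dW hdW (S : Matrix (Fin n) (Fin n) L) (b : HA L e dV hdV dW hdW) = 1) →
          ∀ w : HeightOneSpectrum (𝓞 L), ∃ m : ℕ,
            ((Ideal.absNorm w.asIdeal : ℕ) : ℝ) ^ m ≤
                ((Ideal.absNorm w.asIdeal : ℕ) : ℝ) ^ δ w * (GLn.localHeight (n + n) L w (h : GL (Fin (n + n)) (AdeleRing (𝓞 L) L)) : ℝ) ^ k ∧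
              ∀ a b, Valued.v ((((S : Matrix (Fin n) (Fin n) L) a b : L)) : w.adicCompletion L) ≤ WithZero.exp (m : ℤ) := by
  intro U hU
  classical
  -- the levels of `U` (★ (ρ5))
  obtain ⟨T, m, hT, hU'⟩ := exists_finset_forall_evalAt_mem_congruenceGL_imp_mem (F := Fp L) (E := L) (c := IsCMField.complexConj L) (N := n + n)
    (J := hermD L e dV hdV dW hdW) U hU (fun w => unifAt L w) (fun w => valued_unifAt L w)
  rcases isEmpty_or_nonempty (Fin n) with hn | hn
  · -- degenerate `n = 0`: no entries, `m := 0`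
    refine ⟨∅, fun _ => 0, 0, fun _ _ => rfl, fun S h _ w => ⟨0, ?_, fun a => isEmptyElim a⟩⟩
    simp only [pow_zero, mul_one, le_refl]
  haveI : NeZero (n + n) := ⟨by have := Fin.pos_iff_nonempty.2 hn; omega⟩
  -- the form `J^𝔻` in `GL_{2n}(𝔸_L)` and its heights `H_w(J^𝔻) ≤ q_w^{j_w}`, `j` cofinitely `0`
  obtain ⟨Jm, hJm⟩ := exists_coe_eq_adelicForm_hermD L e dV hdV dW hdW hdV0 hdW0
  obtain ⟨j, hjev, hJw⟩ := exists_cofinite_localHeight_le_pow L Jm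
  -- the defects `δ_w := 2 (m_w + m_{c⁻¹•w} + 4 j_w) + D_w` vanish cofinitely
  have hev : ∀ᶠ w : HeightOneSpectrum (𝓞 L) in cofinite,
      2 * (m w + m ((IsCMField.complexConj L)⁻¹ • w) + 4 * j w) + D w = 0 := by
    have h1 : ∀ᶠ w : HeightOneSpectrum (𝓞 L) in cofinite, m w = 0 := T.eventually_cofinite_notMem.mono hT
    have h2 : ∀ᶠ w : HeightOneSpectrum (𝓞 L) in cofinite, m ((IsCMField.complexConj L)⁻¹ • w) = 0 :=
      (MulAction.injective (β := HeightOneSpectrum (𝓞 L)) (IsCMField.complexConj L)⁻¹).tendsto_cofinite.eventually h1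
    have h4 : ∀ᶠ w : HeightOneSpectrum (𝓞 L) in cofinite, D w = 0 := Bad.eventually_cofinite_notMem.mono hD
    filter_upwards [h1, h2, hjev, h4] with w e1 e2 e3 e4
    simp only [e1, e2, e3, e4, mul_zero, add_zero]
  have hfin := Filter.eventually_cofinite.1 hev
  refine ⟨hfin.toFinset, fun w => 2 * (m w + m ((IsCMField.complexConj L)⁻¹ • w) + 4 * j w) + D w, 4,
    fun w hw => by_contra fun hne => hw (hfin.mem_toFinset.2 hne), ?_⟩
  intro S h hprem w
  -- `H_w(h) = q_w^{a₀}`; both places over `v := w ∩ L⁺` have height `≤ q^{A}`, `A := j_w + a₀ + j_w`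
  obtain ⟨a₀, ha₀⟩ := exists_localHeight_eq_pow L w (h : GL (Fin (n + n)) (AdeleRing (𝓞 L) L))
  have ha := localHeight_le_pow_of_placesOver L e dV hdV dW hdW Jm hJm j hJw h w ha₀
  -- feed the local letter at the single depth `Mv := m_w + m_{c⁻¹•w} + 2A`
  have key := hloc (w.under (𝓞 (Fp L))) ⟨w, rfl⟩ (m w + m ((IsCMField.complexConj L)⁻¹ • w) + 2 * (j w + a₀ + j w)) S ?_
  · refine ⟨2 * (m w + m ((IsCMField.complexConj L)⁻¹ • w) + 2 * (j w + a₀ + j w)) + D w, ?_, fun a b => ?_⟩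
    · have hH : (GLn.localHeight (n + n) L w (h : GL (Fin (n + n)) (AdeleRing (𝓞 L) L)) : ℝ) = ((Ideal.absNorm w.asIdeal : ℕ) : ℝ) ^ a₀ := by
        rw [ha₀, NNReal.coe_pow, NNReal.coe_natCast]
      rw [hH, ← pow_mul, ← pow_add]
      exact le_of_eq (congrArg _ (by ring))
    · have hk := key a b
      push_cast at hk ⊢
      exact hk
  · -- the premise of `hlatU` discharges the premise of `hloc`
    intro u hu hmem
    refine hprem ⟨_, hmem⟩ (archPart_locToAdelic_eq_one L e dV hdV dW hdW _ u) (hU' _ ?_)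
    refine forall_evalAt_finPart_conj_locToAdelic_mem_congruenceGL L e dV hdV dW hdW h (w.under (𝓞 (Fp L))) (fun w'' => unifAt L w'')
      (fun w'' => valued_unifAt L w'') m (fun _ => j w + a₀ + j w) ha u fun w' => congruenceGL_mono ?_ (hu w')
    -- `ϖ^{Mv} ≤ ϖ^{m_{w′} + 2A}` as `m_{w′} + 2A ≤ Mv` for `w′ ∈ {w, c⁻¹ • w}`
    refine pow_le_pow_right_of_le_one' (valuation_unifAt_le_one L w'.1) ?_
    rcases PlacesOver.eq_or_eq_galInv (IsCMField.complexConj L) (IsCMField.complexConj_ne_one L)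
        (⟨w, rfl⟩ : UnitaryGroup.PlacesOver L (w.under (𝓞 (Fp L)))) w' with rfl | rfl
    · show m w + 2 * (j w + a₀ + j w) ≤ _
      omega
    · show m ((IsCMField.complexConj L)⁻¹ • w) + 2 * (j w + a₀ + j w) ≤ _
      omega

end Summit.HodgeConjecture.HodgeConjecture.Cruxes.HLiu418.K2LiuKindOneLineLatticeLetters

end
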